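import Literature.NumberTheory.EllipticCurves.HidaFamilyGaloisRepDatum
import Literature.NumberTheory.EllipticCurves.OchiaiTwoVariableSelmerDual
import Literature.NumberTheory.GaloisRepresentations.NearlyOrdinaryPresentationProofs
import Literature.AlgebraicGeometry.Resolution.RegularLocalRingsUFD
import Literature.RingTheory.KrullDimension.AffineDimension
import Summits.BirchSwinnertonDyer.BirchSwinnertonDyer.Theorems.OneSidedTwistSqueezeX9KatoDivisibilityX9ULedgerDefs
import Summits.BirchSwinnertonDyer.BirchSwinnertonDyer.Theorems.OneSidedTwistSqueezeX9KatoDivisibilityX9ULedgerWeightTwoPointDefs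
import Summits.BirchSwinnertonDyer.BirchSwinnertonDyer.Theorems.OneSidedTwistSqueezeX9KatoDivisibilityX9ULedgerPrincipalPoint
import Summits.BirchSwinnertonDyer.BirchSwinnertonDyer.Theorems.OneSidedTwistSqueezeX9KatoDivisibilityX9ULedgerCollapseStructure

set_option autoImplicit false

-- the summit and its single problem are both named `BirchSwinnertonDyer` (registry layout D-0017)
set_option linter.dupNamespace false

/-!
# The collapse theorem «(Car_W) ∧ (W2ℚ_p) ⟹ (Reg)»: the regularity conjunct of stub 3 in four equivalent readings
# (helper for crux stmt-BirchSwinnertonDyer-20547 `KatoDivisibilityX9`, line `prime_adapted_tau`, stub 3)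

Port (verbatim up to the renaming (Car_W) `CartierPointW D` ↦ the tree's identical term `D.PrincipalPointW` of
`…ULedgerDefs.lean`) of §2 of the bsd-f3-mu cell's kernel-checked sketch `Sketch74.lean` bf97a731e7ef97ad
(planner-bsd-f3-mu-desc g74, 2026-08-29; MEMO-desc §74).  For a Hida datum `D : HidaFamilyGaloisRepDatum W p 𝕀` (tree;
only the field `moduleFinite`, `charP_residueField`, `specW_algebraMap` are used), with (W2ℚ_p) `D.WeightTwoRational` and
`D.specWZp` of `…ULedgerWeightTwoPointDefs.lean`, (Reg) := `Ochiai2006.IsRegular p 𝕀`, (Car_W) := `D.PrincipalPointW`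
(`P_W = ker specW` is principal with a prime generator), (inj) := `Λ ↪ 𝕀`:

* `isRegular_of_principalPointW` — **THM 74.2: (Car_W) ∧ (W2ℚ_p) ⟹ (Reg)** with `𝒪 = ℤ_p` (THM 74.1 of
  `…ULedgerCollapseStructure.lean` applied to `φ = specWZp`; completeness of `𝕀` from module-finiteness over the complete
  `Λ`); `isRegularLocalRing_of_principalPointW`;
* the converse direction (Sketch71 §G = `…ULedgerPrincipalPoint.lean`): `principalPointW_of_injective_of_ufd` ((inj) ∧
  factorial ⟹ (Car_W); in particular Delbourgo's Hypothesis (UF) gives (Car_W)), `principalPointW_of_isRegularLocalRing`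
  (Auslander–Buchsbaum), and the tree's `HidaFamilyGaloisRepDatum.principalPointW_of_isRegular`;
* `isRegular_iff_principalPointW` — **COR 74.3: under (W2ℚ_p), (Reg) ⟺ (Car_W)**; `nonempty_ringEquiv_powerSeries_of_principalPointW`
  (`𝕀 ≃+* ℤ_p⟦T⟧`), `injective_algebraMap_of_principalPointW` ((Car_W) ⟹ (inj)), `isRegular_of_ufd` (COR 74.4: under
  (W2ℚ_p) ∧ (inj), factorial ⟹ (Reg));
* `reg_readings` — D74 TYPED SUMMARY: on a row with a `ℚ_p`-rational weight-two point,
  (Reg) ⟺ (Car_W) ⟺ `𝕀 ≃+* ℤ_p⟦T⟧` ⟺ (`𝕀` regular ∧ (inj)) ⟺ (`𝕀` factorial ∧ (inj)).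

Consequence recorded by the cell (MEMO-desc §74): the stub-3 residual of record reads equivalently EXISTENCE ∧ (Car_W) ∧
(W2ℚ_p).  No ledger item is closed here; BSD is proved for no curve.  References: [Ochiai2006] §3 (Reg); [Delbourgo2008]
§4.2 Hypothesis (UF); [Matsumura1987] Thm. 20.3 (Auslander–Buchsbaum), Thm. 8.4.
-/

noncomputable section

open IsLocalRing
open Literature.NumberTheory.EllipticCurves Literature.AlgebraicGeometry.Resolution
open Literature.NumberTheory.EllipticCurves.HidaFamilyGaloisRepDatum

namespace Summit.BirchSwinnertonDyer.BirchSwinnertonDyer.Theorems.OneSidedTwistSqueezeX9KatoDivisibilityX9ULedger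

section Datum

open scoped MatrixGroups

variable {W : WeierstrassCurve ℚ} {p : ℕ} [Fact p.Prime] {I : Type} [CommRing I] [IsDomain I]
  [IsLocalRing I] [TopologicalSpace I] [IsTopologicalRing I] [Algebra (IwasawaAlgebra p) I]

/-- **THEOREM 74.2 — (Car_W) ∧ (W2ℚ_p) ⟹ (Reg).**  For every Hida datum `D` over a local domain `𝕀`
(module-finite over `Λ`, field (i)) whose weight-two point is `ℚ_p`-rational and CARTIER, `𝕀 ≃+* ℤ_p⟦T⟧`, i.e.
Ochiai's (Reg) holds with `𝒪 = ℤ_p`.  No (inj), (Nor), regularity or dimension hypothesis. -/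
theorem isRegular_of_principalPointW (D : HidaFamilyGaloisRepDatum W p I) (hW2 : D.WeightTwoRational)
    (hC : D.PrincipalPointW) : Ochiai2006.IsRegular p I := by
  haveI := D.moduleFinite
  obtain ⟨ϖ, hϖ, hker⟩ := hC
  letI : Algebra ℤ_[p] I := ((algebraMap (IwasawaAlgebra p) I).comp (PowerSeries.C (R := ℤ_[p]))).toAlgebra
  let φ' : I →ₐ[ℤ_[p]] ℤ_[p] :=
    { D.specWZp hW2 with
      commutes' := fun a => by
        show D.specWZp hW2 (algebraMap (IwasawaAlgebra p) I (PowerSeries.C a)) = a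
        exact D.specWZp_algebraMap_C hW2 a }
  haveI : IsAdicComplete (maximalIdeal (IwasawaAlgebra p)) (IwasawaAlgebra p) :=
    Literature.NumberTheory.GaloisRepresentations.powerSeries_isAdicComplete_maximalIdeal
  haveI : IsAdicComplete (maximalIdeal I) I := isAdicComplete_maximalIdeal_of_module_finite (IwasawaAlgebra p) I
  haveI : IsNoetherianRing I := IsNoetherianRing.of_finite (IwasawaAlgebra p) I
  have hkerφ : RingHom.ker (φ' : I →+* ℤ_[p]) = Ideal.span {ϖ} := by
    rw [← hker, ← D.ker_specWZp hW2]
    rfl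
  exact isRegular_of_ker_eq_span φ' hϖ.ne_zero hkerφ

/-- (Car_W) ∧ (W2ℚ_p) ⟹ `𝕀` is a regular local ring. -/
theorem isRegularLocalRing_of_principalPointW (D : HidaFamilyGaloisRepDatum W p I) (hW2 : D.WeightTwoRational)
    (hC : D.PrincipalPointW) : IsRegularLocalRing I :=
  isRegularLocalRing_of_isRegular (isRegular_of_principalPointW D hW2 hC)

/-- **(inj) ∧ `𝕀` factorial ⟹ (Car_W)** — `P_W` is a prime with `⊥ ≠ P_W` (`X ∈ P_W`, (inj)) and `P_W ≠ 𝔪`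
(`p ∉ P_W`, residue characteristic `p`) of the two-dimensional (integrality over `Λ`) factorial `𝕀`. In
particular Delbourgo's Hypothesis (UF) gives (Car_W). Uses the fields `moduleFinite`, `charP_residueField`,
`specW_algebraMap` of `D`. -/
theorem principalPointW_of_injective_of_ufd (D : HidaFamilyGaloisRepDatum W p I) [UniqueFactorizationMonoid I]
    (hinj : Function.Injective (algebraMap (IwasawaAlgebra p) I)) : D.PrincipalPointW := by
  haveI := D.moduleFinite
  haveI : Algebra.IsIntegral (IwasawaAlgebra p) I := Algebra.IsIntegral.of_finite _ _
  have hdim : ringKrullDim I = 2 := by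
    rw [← Literature.RingTheory.KrullDimension.ringKrullDim_eq_of_isIntegral hinj]
    exact IwasawaAlgebra.ringKrullDim_eq_two p
  haveI : (RingHom.ker D.specW).IsPrime := RingHom.ker_isPrime _
  have hP0 : RingHom.ker D.specW ≠ ⊥ := by
    intro h0
    have hX : algebraMap (IwasawaAlgebra p) I PowerSeries.X ∈ RingHom.ker D.specW := by
      rw [RingHom.mem_ker]; exact D.specW_algebraMap_X
    rw [h0, Ideal.mem_bot] at hX
    exact PowerSeries.X_ne_zero (hinj (by rw [hX, map_zero]))
  have hPm : RingHom.ker D.specW ≠ IsLocalRing.maximalIdeal I := by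
    intro hm
    have hpm : ((p : ℕ) : I) ∈ IsLocalRing.maximalIdeal I := by
      haveI := D.charP_residueField
      rw [← IsLocalRing.residue_eq_zero_iff, map_natCast]
      exact CharP.cast_eq_zero _ p
    rw [← hm, RingHom.mem_ker, map_natCast] at hpm
    exact (Nat.cast_ne_zero.mpr (Fact.out : p.Prime).ne_zero) hpm
  obtain ⟨π, hπ, hP⟩ := eq_span_singleton_of_dim_two hdim hP0 hPm
  exact ⟨π, hπ, hP⟩

-- `IsRegularLocalRing I` is a hypothesis here while `[IsLocalRing I]` is forced by the datum's signature; the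
-- reported overlap (`Nontrivial I` twice) is intrinsic to the statement, not removable.
set_option linter.overlappingInstances false in
/-- **regular ∧ (inj) ⟹ (Car_W)** (Auslander–Buchsbaum: a regular local ring is factorial; tree
`uniqueFactorizationMonoid_of_isRegularLocalRing`). -/
theorem principalPointW_of_isRegularLocalRing (D : HidaFamilyGaloisRepDatum W p I)
    (hinj : Function.Injective (algebraMap (IwasawaAlgebra p) I)) (hreg : IsRegularLocalRing I) :
    D.PrincipalPointW := by
  haveI := uniqueFactorizationMonoid_of_isRegularLocalRing I hreg
  exact principalPointW_of_injective_of_ufd D hinj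

/-- **COROLLARY 74.3 — under (W2ℚ_p): (Reg) ⟺ (Car_W).**  On the rows of the line (`ℚ_p`-rational weight-two
point) Ochiai's printed hypothesis `𝕀 ≅ 𝒪⟦X⟧` IS the statement that the weight-two point of `E` is a Cartier
divisor on the branch — nothing weaker, nothing stronger. -/
theorem isRegular_iff_principalPointW (D : HidaFamilyGaloisRepDatum W p I) (hW2 : D.WeightTwoRational) :
    Ochiai2006.IsRegular p I ↔ D.PrincipalPointW :=
  ⟨principalPointW_of_isRegular D, isRegular_of_principalPointW D hW2⟩

/-- COR 74.3 (b): under (W2ℚ_p), (Car_W) ⟹ `𝕀 ≃+* ℤ_p⟦T⟧` (the DVR `𝒪` of (Reg) is `ℤ_p`: no ramified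
coefficient extension occurs on a branch through a Cartier `ℚ_p`-rational point). -/
theorem nonempty_ringEquiv_powerSeries_of_principalPointW (D : HidaFamilyGaloisRepDatum W p I)
    (hW2 : D.WeightTwoRational) (hC : D.PrincipalPointW) : Nonempty (I ≃+* PowerSeries ℤ_[p]) := by
  haveI := D.moduleFinite
  obtain ⟨ϖ, hϖ, hker⟩ := hC
  letI : Algebra ℤ_[p] I := ((algebraMap (IwasawaAlgebra p) I).comp (PowerSeries.C (R := ℤ_[p]))).toAlgebra
  let φ' : I →ₐ[ℤ_[p]] ℤ_[p] :=
    { D.specWZp hW2 with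
      commutes' := fun a => by
        show D.specWZp hW2 (algebraMap (IwasawaAlgebra p) I (PowerSeries.C a)) = a
        exact D.specWZp_algebraMap_C hW2 a }
  haveI : IsAdicComplete (maximalIdeal (IwasawaAlgebra p)) (IwasawaAlgebra p) :=
    Literature.NumberTheory.GaloisRepresentations.powerSeries_isAdicComplete_maximalIdeal
  haveI : IsAdicComplete (maximalIdeal I) I := isAdicComplete_maximalIdeal_of_module_finite (IwasawaAlgebra p) I
  haveI : IsNoetherianRing I := IsNoetherianRing.of_finite (IwasawaAlgebra p) I
  have hkerφ : RingHom.ker (φ' : I →+* ℤ_[p]) = Ideal.span {ϖ} := by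
    rw [← hker, ← D.ker_specWZp hW2]
    rfl
  exact nonempty_ringEquiv_powerSeries_of_ker_eq_span φ' hϖ.ne_zero hkerφ

/-- COR 74.3 (c): under (W2ℚ_p), (Car_W) ⟹ (inj) `Λ ↪ 𝕀` (so the stub-3 conjunct (inj) is implied too). -/
theorem injective_algebraMap_of_principalPointW (D : HidaFamilyGaloisRepDatum W p I)
    (hW2 : D.WeightTwoRational) (hC : D.PrincipalPointW) :
    Function.Injective (algebraMap (IwasawaAlgebra p) I) :=
  haveI := D.moduleFinite
  injective_algebraMap_of_isRegular (isRegular_of_principalPointW D hW2 hC)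

/-- **COROLLARY 74.4 — under (W2ℚ_p) ∧ (inj): factorial ⟹ (Reg).**  On these rows Delbourgo's Hypothesis
(UF) «`𝐈` has unique factorisation» (Delbourgo 2008 §4.2) already forces `𝐈 ≅ ℤ_p⟦T⟧`: the hierarchy
(Reg) ⟹ (UF) ⟹ (Nor) collapses at its first step. -/
theorem isRegular_of_ufd (D : HidaFamilyGaloisRepDatum W p I) [UniqueFactorizationMonoid I]
    (hinj : Function.Injective (algebraMap (IwasawaAlgebra p) I)) (hW2 : D.WeightTwoRational) :
    Ochiai2006.IsRegular p I :=
  isRegular_of_principalPointW D hW2 (principalPointW_of_injective_of_ufd D hinj)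

/-- **D74 TYPED SUMMARY (the regularity conjunct of stub 3, four equivalent readings).**  On a row with a
`ℚ_p`-rational weight-two point: (Reg) `Ochiai2006.IsRegular p 𝕀` ⟺ (Car_W) ⟺ `𝕀 ≃+* ℤ_p⟦T⟧` ⟺
(`𝕀` regular ∧ (inj)) ⟺ (`𝕀` factorial ∧ (inj)). -/
theorem reg_readings (D : HidaFamilyGaloisRepDatum W p I) (hW2 : D.WeightTwoRational) :
    (Ochiai2006.IsRegular p I ↔ D.PrincipalPointW) ∧
    (D.PrincipalPointW ↔ Nonempty (I ≃+* PowerSeries ℤ_[p])) ∧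
    (D.PrincipalPointW ↔ IsRegularLocalRing I ∧ Function.Injective (algebraMap (IwasawaAlgebra p) I)) ∧
    (D.PrincipalPointW ↔
      UniqueFactorizationMonoid I ∧ Function.Injective (algebraMap (IwasawaAlgebra p) I)) := by
  haveI := D.moduleFinite
  refine ⟨isRegular_iff_principalPointW D hW2, ⟨nonempty_ringEquiv_powerSeries_of_principalPointW D hW2, ?_⟩,
    ⟨fun hC => ⟨isRegularLocalRing_of_principalPointW D hW2 hC, injective_algebraMap_of_principalPointW D hW2 hC⟩,
      fun h => principalPointW_of_isRegularLocalRing D h.2 h.1⟩,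
    ⟨fun hC => ⟨(isRegular_of_principalPointW D hW2 hC).uniqueFactorizationMonoid,
      injective_algebraMap_of_principalPointW D hW2 hC⟩,
      fun h => by haveI := h.1; exact principalPointW_of_injective_of_ufd D h.2⟩⟩
  rintro ⟨e⟩
  exact principalPointW_of_isRegular D ⟨ℤ_[p], inferInstance, inferInstance, inferInstance, inferInstance,
    inferInstance, (faithfulSMul_iff_algebraMap_injective ℤ_[p] ℤ_[p]).mpr (fun a b h => h), ⟨e⟩⟩

end Datum

end Summit.BirchSwinnertonDyer.BirchSwinnertonDyer.Theorems.OneSidedTwistSqueezeX9KatoDivisibilityX9ULedger
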